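import Mathlib
import HarnessLib
import Summits.RiemannHypothesis.RiemannHypothesis.Theorems.IntegerScrewParityDefect

/-!
# Route `IntegerScrew` — the LEIBNIZ RULE of the truncated multiplicative walk on products of parity functions:
# `ℒ_M(φ_pφ_q) = φ_q·ℒ_Mφ_p + φ_p·ℒ_Mφ_q` for distinct primes `p, q`, hence the exact eigen-relation with defect
# `ℒ_M(φ_pφ_q) = −(λ_p + λ_q)φ_pφ_q + φ_q𝟙[p∤x]r_p + φ_p𝟙[q∤x]r_q` (CONTINUUM-LIMIT 23.18 (f), `S = {p, q}`)

Every jump of the walk (`IntegerScrewWalkGenerator.walkGen_sum_eq_arith`: births `k → kn`, deaths `k → k/d`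
with rates `Λ(n)/(nL)`, `Λ(d)/L`) multiplies or divides the state by a PRIME POWER `r^a`; such a jump changes
`φ_p` only if `r = p` (`parityFun_mul_eq_of_ne`, `parityFun_div_eq_of_not_dvd`).  So along every jump at most
one of `φ_p, φ_q` moves, the cross term `Δφ_p·Δφ_q` vanishes (`vonMangoldt_mul_parity_cross_mul/_div`), and the
generator acts on `φ_pφ_q` as a derivation (`walkGen_parity_mul`).  With `IntegerScrewParityDefect.walkGen_parity`
this is the additivity `λ_{p,q} = λ_p + λ_q` of the prime-parity ladder at the level of exact eigen-relations
(`walkGen_parity_mul_eq`; PIVOT-LAW 13.10 (iv)).  RH-free.  Reference for the walk: M. Suzuki, J. Lond. Math.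
Soc. (2) 108 (2023) 1448–1487 [Suzuki2023] (PROP. N4 of the rh-explicit A6-PIVOT programme).
-/

noncomputable section

set_option linter.dupNamespace false -- D-0017: `Summit.<S>.<S>.…` is the designed namespace

namespace Summit.RiemannHypothesis.RiemannHypothesis.Theorems.IntegerScrew

open Finset ArithmeticFunction

/-- Multiplying by a power of a prime `r ≠ p` does not change `φ_p`. -/
theorem parityFun_mul_eq_of_ne {p r : ℕ} (hp : p.Prime) (hr : r.Prime) (hpr : p ≠ r) (k a : ℕ) :
    parityFun p (k * r ^ a) = parityFun p k := by
  have hiff : p ∣ k * r ^ a ↔ p ∣ k := by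
    constructor
    · intro h
      rcases (Nat.Prime.dvd_mul hp).1 h with h1 | h1
      · exact h1
      · exact absurd ((Nat.prime_dvd_prime_iff_eq hp hr).1 (hp.dvd_of_dvd_pow h1)) hpr
    · intro h; exact dvd_mul_of_dvd_left h _
  by_cases h : p ∣ k
  · rw [parityFun_of_dvd h, parityFun_of_dvd (hiff.2 h)]
  · rw [parityFun_of_not_dvd h, parityFun_of_not_dvd (fun h' => h (hiff.1 h'))]

/-- Dividing by a divisor `d` of `k` with `p ∤ d` does not change `φ_p`. -/
theorem parityFun_div_eq_of_not_dvd {p d k : ℕ} (hp : p.Prime) (hd : d ∣ k) (hpd : ¬ p ∣ d) :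
    parityFun p (k / d) = parityFun p k := by
  have hk : k = d * (k / d) := (Nat.mul_div_cancel' hd).symm
  have hiff : p ∣ k / d ↔ p ∣ k := by
    constructor
    · intro h; rw [hk]; exact dvd_mul_of_dvd_right h _
    · intro h
      rw [hk] at h
      rcases (Nat.Prime.dvd_mul hp).1 h with h1 | h1
      · exact absurd h1 hpd
      · exact h1
  by_cases h : p ∣ k
  · rw [parityFun_of_dvd h, parityFun_of_dvd (hiff.2 h)]
  · rw [parityFun_of_not_dvd h, parityFun_of_not_dvd (fun h' => h (hiff.1 h'))]

/-- Along a birth `k → kn` the cross term `Λ(n)·Δφ_p·Δφ_q` vanishes (`p ≠ q` primes): `Λ(n) ≠ 0` forces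
`n = r^a`, and `r` differs from `p` or from `q`. -/
theorem vonMangoldt_mul_parity_cross_mul {p q : ℕ} (hp : p.Prime) (hq : q.Prime) (hpq : p ≠ q) (k n : ℕ) :
    (Λ n : ℝ) * ((parityFun p (k * n) - parityFun p k) * (parityFun q (k * n) - parityFun q k)) = 0 := by
  by_cases hΛ : Λ n = 0
  · rw [hΛ]; simp
  · obtain ⟨r, a, hr, _, rfl⟩ := vonMangoldt_ne_zero_iff.1 hΛ
    have hrp : r.Prime := hr.nat_prime
    by_cases hpr : p = r
    · have hqr : q ≠ r := fun h => hpq (hpr.trans h.symm)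
      rw [parityFun_mul_eq_of_ne hq hrp hqr, sub_self, mul_zero, mul_zero]
    · rw [parityFun_mul_eq_of_ne hp hrp hpr, sub_self, zero_mul, mul_zero]

/-- Along a death `k → k/d` (`d ∣ k`) the cross term `Λ(d)·Δφ_p·Δφ_q` vanishes (`p ≠ q` primes). -/
theorem vonMangoldt_mul_parity_cross_div {p q : ℕ} (hp : p.Prime) (hq : q.Prime) (hpq : p ≠ q) {k d : ℕ}
    (hd : d ∣ k) :
    (Λ d : ℝ) * ((parityFun p (k / d) - parityFun p k) * (parityFun q (k / d) - parityFun q k)) = 0 := by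
  by_cases hΛ : Λ d = 0
  · rw [hΛ]; simp
  · obtain ⟨r, a, hr, _, rfl⟩ := vonMangoldt_ne_zero_iff.1 hΛ
    have hrp : r.Prime := hr.nat_prime
    by_cases hpr : p = r
    · have hqr : q ≠ r := fun h => hpq (hpr.trans h.symm)
      have hqd : ¬ q ∣ r ^ a := fun h => hqr ((Nat.prime_dvd_prime_iff_eq hq hrp).1 (hq.dvd_of_dvd_pow h))
      rw [parityFun_div_eq_of_not_dvd hq hd hqd, sub_self, mul_zero, mul_zero]
    · have hpd : ¬ p ∣ r ^ a := fun h => hpr ((Nat.prime_dvd_prime_iff_eq hp hrp).1 (hp.dvd_of_dvd_pow h))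
      rw [parityFun_div_eq_of_not_dvd hp hd hpd, sub_self, zero_mul, mul_zero]

/-- **Leibniz rule**: for distinct primes `p, q` and every state `k`,
`Σ_j walkGen(k,j)·φ_p(j)φ_q(j) = φ_q(k)·Σ_j walkGen(k,j)φ_p(j) + φ_p(k)·Σ_j walkGen(k,j)φ_q(j)`. -/
theorem walkGen_parity_mul {M p q : ℕ} (hp : p.Prime) (hq : q.Prime) (hpq : p ≠ q) (k : St M) :
    ∑ j : St M, walkGen M k j * (parityFun p j * parityFun q j) =
      parityFun q k * ∑ j : St M, walkGen M k j * parityFun p j +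
        parityFun p k * ∑ j : St M, walkGen M k j * parityFun q j := by
  rw [walkGen_sum_eq_arith M (fun j => parityFun p j * parityFun q j) k,
    walkGen_sum_eq_arith M (fun j => parityFun p j) k, walkGen_sum_eq_arith M (fun j => parityFun q j) k]
  -- births
  have hb : ∀ n ∈ Finset.Icc 1 (M / k),
      (Λ n : ℝ) / ((n : ℝ) * Real.log M) * (parityFun p ((k : ℕ) * n) * parityFun q ((k : ℕ) * n) -
        parityFun p k * parityFun q k) =
      parityFun q k * ((Λ n : ℝ) / ((n : ℝ) * Real.log M) * (parityFun p ((k : ℕ) * n) - parityFun p k)) +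
        parityFun p k * ((Λ n : ℝ) / ((n : ℝ) * Real.log M) * (parityFun q ((k : ℕ) * n) - parityFun q k)) := by
    intro n _
    have hc := vonMangoldt_mul_parity_cross_mul hp hq hpq (k : ℕ) n
    have e : (Λ n : ℝ) / ((n : ℝ) * Real.log M) * (parityFun p ((k : ℕ) * n) * parityFun q ((k : ℕ) * n) -
        parityFun p k * parityFun q k) -
      (parityFun q k * ((Λ n : ℝ) / ((n : ℝ) * Real.log M) * (parityFun p ((k : ℕ) * n) - parityFun p k)) +
        parityFun p k * ((Λ n : ℝ) / ((n : ℝ) * Real.log M) * (parityFun q ((k : ℕ) * n) - parityFun q k))) =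
      (1 / ((n : ℝ) * Real.log M)) *
        ((Λ n : ℝ) * ((parityFun p ((k : ℕ) * n) - parityFun p k) * (parityFun q ((k : ℕ) * n) - parityFun q k))) := by
      rw [div_eq_mul_one_div]; ring
    rw [hc, mul_zero] at e
    linarith
  -- deaths
  have hd : ∀ d ∈ (k : ℕ).divisors,
      (Λ d : ℝ) / Real.log M * (parityFun p ((k : ℕ) / d) * parityFun q ((k : ℕ) / d) - parityFun p k * parityFun q k) =
      parityFun q k * ((Λ d : ℝ) / Real.log M * (parityFun p ((k : ℕ) / d) - parityFun p k)) +
        parityFun p k * ((Λ d : ℝ) / Real.log M * (parityFun q ((k : ℕ) / d) - parityFun q k)) := by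
    intro d hdm
    have hdk : d ∣ (k : ℕ) := (Nat.mem_divisors.1 hdm).1
    have hc := vonMangoldt_mul_parity_cross_div hp hq hpq hdk
    have e : (Λ d : ℝ) / Real.log M * (parityFun p ((k : ℕ) / d) * parityFun q ((k : ℕ) / d) -
        parityFun p k * parityFun q k) -
      (parityFun q k * ((Λ d : ℝ) / Real.log M * (parityFun p ((k : ℕ) / d) - parityFun p k)) +
        parityFun p k * ((Λ d : ℝ) / Real.log M * (parityFun q ((k : ℕ) / d) - parityFun q k))) =
      (1 / Real.log M) *
        ((Λ d : ℝ) * ((parityFun p ((k : ℕ) / d) - parityFun p k) * (parityFun q ((k : ℕ) / d) - parityFun q k))) := by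
      rw [div_eq_mul_one_div]; ring
    rw [hc, mul_zero] at e
    linarith
  rw [Finset.sum_congr rfl hb, Finset.sum_congr rfl hd, Finset.sum_add_distrib, Finset.sum_add_distrib,
    ← Finset.mul_sum, ← Finset.mul_sum, ← Finset.mul_sum, ← Finset.mul_sum]
  ring

/-- **Exact eigen-relation for `φ_pφ_q`** (`p ≠ q` primes): with `λ_r = r log r/(r−1)` and the blocked-birth
defect `D_r(k) = 𝟙[r ∤ k]·(log r/(r−1) − Σ_{n ≤ M/k, r|n}Λ(n)/n)`,
`Σ_j walkGen(k,j)φ_p(j)φ_q(j) = −((λ_p + λ_q)/log M)·φ_p(k)φ_q(k) + (1/log M)·(φ_q(k)D_p(k) + φ_p(k)D_q(k))` —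
CONTINUUM-LIMIT 23.18 (f) for `S = {p, q}`: additivity `λ_{p,q} = λ_p + λ_q` at the level of exact relations. -/
theorem walkGen_parity_mul_eq {M p q : ℕ} (hp : p.Prime) (hq : q.Prime) (hpq : p ≠ q) (k : St M) :
    ∑ j : St M, walkGen M k j * (parityFun p j * parityFun q j) =
      -(((p : ℝ) * Real.log p / ((p : ℝ) - 1) + (q : ℝ) * Real.log q / ((q : ℝ) - 1)) / Real.log M) *
          (parityFun p k * parityFun q k) +
        (1 / Real.log M) *
          (parityFun q k * (if p ∣ (k : ℕ) then 0 else
              (Real.log p / ((p : ℝ) - 1) - ∑ n ∈ (Icc 1 (M / k)).filter (fun n => p ∣ n), Λ n / n)) +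
            parityFun p k * (if q ∣ (k : ℕ) then 0 else
              (Real.log q / ((q : ℝ) - 1) - ∑ n ∈ (Icc 1 (M / k)).filter (fun n => q ∣ n), Λ n / n))) := by
  rw [walkGen_parity_mul hp hq hpq k, walkGen_parity hp k, walkGen_parity hq k]
  ring

end Summit.RiemannHypothesis.RiemannHypothesis.Theorems.IntegerScrew

end
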